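import Summits.BirchSwinnertonDyer.BirchSwinnertonDyer.Theorems.EisensteinPrimesMazurMCOnX1RankZeroInterludeResidualGL1Even
import Literature.NumberTheory.IwasawaTheory.GreenbergCyclicOrderPTrivialProofs
import HarnessLib

/-!
# Crux `MazurMCOnX1RankZero` (item stmt-BirchSwinnertonDyer-19035), line `interlude_with_torsion`, road B input [Even]:
# the TRIVIAL-MODULE case WITHOUT Greenberg's Lemma 5.9 (kernel theorem, no named fact)

Cell `bsd-eis` (host `run/shared/lean/pub/bsd-eis/`), seat `bsd-eis-lam-a` g19 (PART 1b seat (4); `--supports`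
stmt-BirchSwinnertonDyer-19035 as a HELPER; no claim, closes nothing).  The registered skeleton `interlude_with_torsion`
v13 closes road B's input [Even] (`greenbergEvenInput_of_stubs`) by
`EvenTransport.greenbergEvenInput_of_lemma59 stub_publishedL59`, i.e. MODULO the PUBLISHED named fact
`Literature.NumberTheory.IwasawaTheory.greenberg1999_lemma59_even_finite` (Greenberg, LNM 1716, §5 Lemma 5.9: `p` odd,
`#Θ = p`, `Θ` even ⟹ `H¹(ℚ_Σ/ℚ_∞, Θ)` finite).  The proof of `greenbergEvenInput_of_lemma59` uses that fact POINTWISE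
(once for `M`, once for the twist `M ⊗ ε_K`).  For a module `M` with TRIVIAL `Γ_ℚ`-action — the residual line `ℤ/p` of a
curve with a rational `p`-torsion point up to isogeny, i.e. the `θ = 𝟙` stratum of the type-A rows — Lemma 5.9 is now a
TREE THEOREM (`Literature/NumberTheory/IwasawaTheory/GreenbergCyclicOrderPTrivialProofs.lean`,
`GreenbergCyclicOrderPTrivial.greenberg1999_lemma59_even_finite_of_trivial`: `ℚ` is `p`-rational, so
`H¹(ℚ_{{p,∞}}/ℚ_∞, ℤ/p) = 0`), and this file records the corresponding instance of [Even] with NO named fact: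

* `greenbergEvenInput_of_trivial` — the conclusion of `stub_greenbergEvenInput` (skeleton v10/v11 type, token for
  token) for every `M` of order `p` on which `Γ_ℚ` acts trivially; proof = the `c₀ = +1` branch of
  `greenbergEvenInput_of_lemma59` with Lemma 5.9 replaced by the kernel theorem.

What a LEAD can do with it (said, not done — W-79): on the sub-population of crux 5 where the residual isogeny character
is trivial, the cone input `stub_publishedL59` is not needed; a reshaped skeleton may case on `θ = 𝟙`.  HONEST FRAMING:
helper theorem; nothing about BSD, Mazur's main conjecture or IMC2 is asserted; the registered PUB stub
`stub_publishedL59` (all even `Θ`) is NOT discharged; 0 cells / labels / tiers move.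
[cite: Greenberg1999LNM, §5 Lemma 5.9 and proof of Prop. 5.10] [cite: SerreGaloisCohomology1997, I §2.4]
-/

noncomputable section

set_option linter.dupNamespace false
set_option autoImplicit false

open scoped NumberField Pointwise
open Field IsDedekindDomain
open Literature.NumberTheory.GaloisRepresentations
open Literature.NumberTheory.EllipticCurves Literature.NumberTheory.EllipticCurves.GreenbergSelmer
open Literature.NumberTheory.EllipticCurves.GreenbergVatsal2000
open Literature.NumberTheory.IwasawaTheory

namespace Summit.BirchSwinnertonDyer.BirchSwinnertonDyer.Theorems.InterludeWithTorsion.EvenTransport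

/-- **[Even] for a TRIVIAL residual module, unconditionally.**  For `K` imaginary quadratic, `p` odd, `κ` the
cyclotomic `ℤ_p`-extension of `K` and `M` of order `p` with TRIVIAL `Γ_ℚ`-action (compatible with the `Γ_K`-action):
there is `τ ∈ Γ_ℚ ∖ res(Γ_K)` (a complex conjugation `c₀`) with `(1 + T_{c₀}) · H¹_{unr outside p}(K_∞, M)` finite —
the conclusion of `stub_greenbergEvenInput`, token for token, with the extra triviality hypothesis.  Proof: the
`c₀ = +1` branch of `greenbergEvenInput_of_lemma59` (Core⁺, `finite_image_add_cycSwapH1`), the finiteness over `ℚ_∞`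
being the KERNEL THEOREM `GreenbergCyclicOrderPTrivial.greenberg1999_lemma59_even_finite_of_trivial` (indeed
`H¹_{unr outside p}(ℚ_∞, M) = 0`: `ℚ` is `p`-rational) instead of the named fact `greenberg1999_lemma59_even_finite`.
[cite: Greenberg1999LNM, §5 Lemma 5.9 (p. 142)] [cite: SerreGaloisCohomology1997, I §2.4] -/
theorem greenbergEvenInput_of_trivial :
    ∀ (K : Type) [Field K] [NumberField K] [IsGalois ℚ K], IsImaginaryQuadratic K →
      ∀ (p : ℕ) [Fact p.Prime], p ≠ 2 →
      ∀ (κ : ZpExtension K p) (hκ : κ.IsCyclotomic),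
      ∀ (M : Type) [AddCommGroup M] [DistribMulAction (absoluteGaloisGroup ℚ) M]
        [DistribMulAction (absoluteGaloisGroup K) M] [TopologicalSpace M] [DiscreteTopology M],
        Nat.card M = p →
        ∀ (hM : ∀ (σ : absoluteGaloisGroup K) (m : M), σ • m = (absGaloisRestrict ℚ K σ) • m),
        (∀ (σ : absoluteGaloisGroup ℚ) (m : M), σ • m = m) →
        ∃ τ : absoluteGaloisGroup ℚ, τ ∉ Set.range (absGaloisRestrict ℚ K) ∧
          (((fun c ↦ c + cycSwapH1 κ hκ M hM τ c) ''
              (unramifiedOutside κ.kerSubgroup M p ∅ : Set (subgroupH1 κ.kerSubgroup M))).Finite ∨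
            ((fun c ↦ c - cycSwapH1 κ hκ M hM τ c) ''
              (unramifiedOutside κ.kerSubgroup M p ∅ : Set (subgroupH1 κ.kerSubgroup M))).Finite) := by
  intro K _ _ _ hK p _ hp2 κ hκ M _ _ _ _ _ hcard hM htriv
  haveI : Fact (Module.finrank ℚ K = 2) := ⟨hK.1⟩
  -- `τ = c₀`, a complex conjugation; it acts trivially on `M`
  obtain ⟨c₀, hc₀cc⟩ := exists_isComplexConjugation (Rat.castHom ℝ)
  have hc₀ : c₀ * c₀ = 1 := by rw [← pow_two]; exact hc₀cc.sq_eq_one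
  have hc₀K : c₀ ∉ Set.range (absGaloisRestrict ℚ K) := hc₀cc.not_mem_range_absGaloisRestrict hK.2.isComplex
  refine ⟨c₀, hc₀K, Or.inl ?_⟩
  -- the (trivial) `Γ_ℚ`-action is continuous and even
  have hMQ : ∀ m : M, Continuous fun g : absoluteGaloisGroup ℚ ↦ g • m := fun m ↦ by
    have e : (fun g : absoluteGaloisGroup ℚ ↦ g • m) = fun _ ↦ m := funext fun g ↦ htriv g m
    rw [e]
    exact continuous_const
  have hev : ∀ c : absoluteGaloisGroup ℚ, IsComplexConjugation (Rat.castHom ℝ) c → ∀ m : M, c • m = m :=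
    fun c _ m ↦ htriv c m
  -- Lemma 5.9 over `ℚ_∞` for the trivial module: a tree theorem
  have hκQ := CyclotomicZp.isCyclotomic_zpExtension p
  have hfinQ := GreenbergCyclicOrderPTrivial.greenberg1999_lemma59_even_finite_of_trivial p hp2
    (CyclotomicZp.zpExtension p) hκQ M hcard hMQ hev htriv
  exact finite_image_add_cycSwapH1 κ hκ (CyclotomicZp.zpExtension p) hκQ M hM hMQ hc₀ hc₀K hp2 hcard hfinQ

end Summit.BirchSwinnertonDyer.BirchSwinnertonDyer.Theorems.InterludeWithTorsion.EvenTransport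

end
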